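import Literature.NumberTheory.Transcendental.KaehlerHodgePreHilbert
import Literature.NumberTheory.Transcendental.KaehlerHodgeDolbeaultHarmonicProofs
import Literature.NumberTheory.Transcendental.KaehlerHodgeDolbeaultHarmonicSubspaceProofs
import Literature.NumberTheory.Transcendental.KaehlerHodgeTypeProofs
import Literature.Analysis.OperatorTheory.AbstractHodgeDecomposition
import HarnessLib

/-!
# The `∂̄`-Hodge decomposition on `A^{p,q}(M)` reduced to Warner's analytic theorems 6.5 and 6.6
# for `Δ_∂̄` (Voisin, Thm. 5.22 ⇒ Thm. 5.24)

C. Voisin, *Hodge Theory and Complex Algebraic Geometry I* (2002), proves the Hodge theorem for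
`Δ_∂̄` (Thm. 5.24: `A^{p,q}(X) = ℋ^{p,q} ⊕ Δ_∂̄(A^{p,q}(X))`, `ℋ^{p,q}` finite-dimensional) from
Thm. 5.22 — the elliptic theory, "which we will use without proof (see Demailly 1996)" — by the
argument of F. W. Warner, *Foundations of Differentiable Manifolds and Lie Groups*, GTM 94 (1983),
proof of Thm. 6.8 (pp. 223–224), whose only analytic inputs are Warner's Theorems 6.5 (regularity
of weak solutions) and 6.6 (compactness) for the Laplacian in question on its inner product space
of smooth sections. That argument is formalised in the abstract as
`Literature.Analysis.OperatorTheory.AbstractHodge.*` (`AbstractHodgeDecomposition.lean`); the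
Hermitian inner product space `A^k(M; ℂ)` is `CL2SmoothForms o k` (`KaehlerHodgePreHilbert.lean`).
This file instantiates it for `Δ_∂̄` on the `(p,q)`-forms of a compact complex manifold with a
smooth Hermitian metric:

* `Literature.Geometry.Kaehler.IsSmoothForm.dolbeaultLaplacian` — `Δ_∂̄` preserves smoothness;
* `cl2Inner_dolbeaultLaplacian_comm` — **`Δ_∂̄` is symmetric**, `⟪Δ_∂̄ α, β⟫ = ⟪α, Δ_∂̄ β⟫` on
  smooth complex forms (Voisin, Lemma 5.8 / §5.1.3: `∂̄*` is the formal adjoint of `∂̄`; the tree's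
  `MForm.cl2Inner_dolbeaultBar_left_of_isHermitian`);
* `CL2SmoothForms.dolbeaultLaplacian o h` — `Δ_∂̄` as a `ℂ`-linear operator on `A^k(M; ℂ)`,
  symmetric (`CL2SmoothForms.dolbeaultLaplacian_isSymmetric`);
* `CL2SmoothForms.pq o p q` — the subspace `A^{p,q}(M) ≤ A^{p+q}(M; ℂ)` of forms of type `(p,q)`,
  invariant under `Δ_∂̄` (`Δ_∂̄` is bihomogeneous, `dolbeaultLaplacian_typeComponent`), with the
  restricted operator `CL2SmoothForms.pqLaplacian o p q h : A^{p,q} →ₗ[ℂ] A^{p,q}`, symmetric, whose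
  kernel is the `∂̄`-harmonic `(p,q)`-forms (`CL2SmoothForms.mem_ker_pqLaplacian_iff`);
* `exists_isDolbeaultHarmonic_add_dolbeaultLaplacian_of_regularity_of_compactness` — **Voisin's
  Thm. 5.24 (i), `A^{p,q} = ℋ^{p,q} + Δ_∂̄(A^{p,q})`, from Warner 6.5 and 6.6 for `Δ_∂̄` on
  `A^{p,q}(M)`** (hypotheses `hR`, `hC` stated verbatim on the inner product space
  `CL2SmoothForms.pq o p q`);
* `finite_dolbeaultHarmonicForms_of_compactness` — **`ℋ^{p,q}` is finite-dimensional from 6.6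
  alone** (the named fact `finite_dolbeaultHarmonicForms g o` of `KaehlerHodge.lean` at a complex
  manifold, from the compactness hypothesis for `Δ_∂̄` on `A^{p,q}`).

No named fact is introduced; the analytic theorems enter as explicit hypotheses. The existence and
uniqueness of harmonic representatives of Dolbeault classes (the named fact
`existsUnique_isDolbeaultHarmonic_mk_eq`) is derived from the same hypotheses in the companion
`KaehlerHodgeEllipticRepresentativeProofs.lean`.

## References

* C. Voisin, *Hodge Theory and Complex Algebraic Geometry I* (2002), §5.1.3 Lemma 5.8, §5.1.4
  Cor. 5.13, Def. 5.14, §5.2.3 Thm. 5.22, §5.3.1 Thm. 5.24, Cor. 5.25.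
  [cite: VoisinHodgeI2002, Thm. 5.22 and Thm. 5.24]
* F. W. Warner, *Foundations of Differentiable Manifolds and Lie Groups*, GTM 94 (1983), 6.5, 6.6,
  6.8 (pp. 222–224). [cite: WarnerGTM94, Thm. 6.8 (proof), pp. 223–224]
* D. Huybrechts, *Complex Geometry* (2005), Lemma 3.2.3, Lemma 3.2.5, Prop. 3.2.6.
-/

noncomputable section

open scoped Manifold ContDiff Topology ComplexConjugate ComplexInnerProductSpace
open Bundle Module Filter Literature.Geometry.Kaehler Literature.Analysis.OperatorTheory

namespace Literature.NumberTheory.Transcendental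

-- The identification `TangentSpace I x = E` is an abuse of definitional equality (see
-- `NormedSpace.fromTangentSpace`); as in Mathlib's tangent-bundle files we let `isDefEq` unfold it.
set_option backward.isDefEq.respectTransparency false

variable {E : Type*} [NormedAddCommGroup E] [NormedSpace ℂ E] [FiniteDimensional ℂ E]
  {n : ℕ} [Fact (finrank ℝ E = n)]
  {M : Type*} [TopologicalSpace M] [ChartedSpace E M]
  [IsManifold 𝓘(ℂ, E) ω M] [IsManifold 𝓘(ℝ, E) ∞ M]
  [RiemannianBundle (fun x : M ↦ TangentSpace 𝓘(ℝ, E) x)]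
  [IsContMDiffRiemannianBundle 𝓘(ℝ, E) ∞ E (fun x : M ↦ TangentSpace 𝓘(ℝ, E) x)]
  (o : (x : M) → Orientation ℝ (TangentSpace 𝓘(ℝ, E) x) (Fin n)) {k m : ℕ}

/-! ### `Δ_∂̄` preserves smoothness -/

/-- **`Δ_∂̄` maps smooth forms to smooth forms** on a complex manifold with a `C^∞` metric and an
orientation family with smooth volume form (Voisin (2002), §5.1.4: `Δ_∂̄` is a differential
operator on `A^k`): `∂̄` and `∂̄*` preserve smoothness (`IsSmoothForm.dolbeaultBar`,
`IsSmoothForm.dolbeaultBarAdjoint`); by cases on the degree pattern of `dolbeaultLaplacian`.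
[cite: VoisinHodgeI2002, §5.1.4, Def. 5.14] -/
theorem _root_.Literature.Geometry.Kaehler.IsSmoothForm.dolbeaultLaplacian
    (ho : IsSmoothForm (riemannianVolumeForm o)) (h : k + m = n) {α : MForm 𝓘(ℝ, E) M ℂ k}
    (hα : IsSmoothForm α) : IsSmoothForm (dolbeaultLaplacian o k m h α) := by
  rcases k with - | k <;> rcases m with - | m
  · exact isSmoothForm_zero
  · exact IsSmoothForm.dolbeaultBarAdjoint o ho _ hα.dolbeaultBar
  · exact (IsSmoothForm.dolbeaultBarAdjoint o ho _ hα).dolbeaultBar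
  · exact (IsSmoothForm.dolbeaultBarAdjoint o ho h hα).dolbeaultBar.add
      (IsSmoothForm.dolbeaultBarAdjoint o ho _ hα.dolbeaultBar)

omit [IsManifold 𝓘(ℂ, E) ω M] [IsManifold 𝓘(ℝ, E) ∞ M]
  [IsContMDiffRiemannianBundle 𝓘(ℝ, E) ∞ E (fun x : M ↦ TangentSpace 𝓘(ℝ, E) x)] in
/-- **`Δ_∂̄` preserves the type `(p,q)`** (it is bihomogeneous of bidegree `(0,0)`; Huybrechts
(2005), Prop. 3.2.6 (i); Voisin (2002), §6.1.2), for a metric Hermitian in the instance form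
`hJ : ⟪Jv, Jw⟫ = ⟪v, w⟫`: from `dolbeaultLaplacian_typeComponent` and
`IsOfType.typeComponent_eq_self` / `isOfType_typeComponent_holds`. [cite: VoisinHodgeI2002, §6.1.2] -/
theorem IsOfType.dolbeaultLaplacian
    (hJ : ∀ (x : M) (v w : TangentSpace 𝓘(ℝ, E) x),
      inner ℝ (tangentJ E x v) (tangentJ E x w) = inner ℝ v w)
    (h : k + m = n) {p q : ℕ} {α : MForm 𝓘(ℝ, E) M ℂ k} (hα : IsOfType p q α) :
    IsOfType p q (dolbeaultLaplacian o k m h α) := by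
  have hpq : p + q = k := hα.add_eq
  have := dolbeaultLaplacian_typeComponent o hJ h p q α
  rw [hα.typeComponent_eq_self] at this
  rw [this]
  exact isOfType_typeComponent_holds hpq _

/-! ### `Δ_∂̄` is symmetric for the Hermitian `L²` product -/

section Symmetric

variable [MeasurableSpace E] [BorelSpace E] [T2Space M] [CompactSpace M]
  [IsContinuousRiemannianBundle E (fun x : M ↦ TangentSpace 𝓘(ℝ, E) x)]

/-- The conjugate partner of the adjointness `⟪∂̄α, β⟫ = ⟪α, ∂̄*β⟫`: `⟪∂̄*β, α⟫ = ⟪β, ∂̄α⟫`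
(Voisin (2002), Lemma 5.8; from `MForm.cl2Inner_dolbeaultBar_left_of_isHermitian` and the
Hermitian symmetry `MForm.cl2Inner_conj_symm`). [cite: VoisinHodgeI2002, §5.1.3, Lemma 5.8] -/
theorem cl2Inner_dolbeaultBarAdjoint_left_of_isHermitian
    (hJ : ∀ (x : M) (v w : TangentSpace 𝓘(ℝ, E) x),
      inner ℝ (tangentJ E x v) (tangentJ E x w) = inner ℝ v w)
    (ho : IsSmoothForm (riemannianVolumeForm o)) (h : (k + 1) + m = n)
    {α : MForm 𝓘(ℝ, E) M ℂ k} {β : MForm 𝓘(ℝ, E) M ℂ (k + 1)}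
    (hα : IsSmoothForm α) (hβ : IsSmoothForm β) :
    MForm.cl2Inner o (dolbeaultBarAdjoint o h β) α = MForm.cl2Inner o β (dolbeaultBar α) := by
  rw [← MForm.cl2Inner_conj_symm o α, ← MForm.cl2Inner_dolbeaultBar_left_of_isHermitian o hJ ho h hα hβ,
    MForm.cl2Inner_conj_symm]

/-- **`Δ_∂̄` is `L²`-symmetric on smooth complex forms** of a compact complex manifold with a smooth
metric, Hermitian in the instance form `hJ`, and an orientation family with smooth volume form:
`⟪Δ_∂̄ α, β⟫ = ⟪α, Δ_∂̄ β⟫` (Voisin (2002), §5.1.3–5.1.4: `Δ_∂̄ = ∂̄∂̄* + ∂̄*∂̄` with `∂̄*` the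
formal adjoint of `∂̄`, Lemma 5.8, so that `(α, Δβ) = (∂̄α, ∂̄β) + (∂̄*α, ∂̄*β)`, proof of
Lemma 5.12). The four degree patterns of `dolbeaultLaplacian` are treated separately; each side is
reduced to `⟪∂̄*α, ∂̄*β⟫ + ⟪∂̄α, ∂̄β⟫` (or one of the two terms) by the adjointness
`MForm.cl2Inner_dolbeaultBar_left_of_isHermitian` and its conjugate partner.
[cite: VoisinHodgeI2002, §5.1.4, Lemma 5.12] -/
theorem cl2Inner_dolbeaultLaplacian_comm
    (hJ : ∀ (x : M) (v w : TangentSpace 𝓘(ℝ, E) x),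
      inner ℝ (tangentJ E x v) (tangentJ E x w) = inner ℝ v w)
    (ho : IsSmoothForm (riemannianVolumeForm o)) (h : k + m = n)
    {α β : MForm 𝓘(ℝ, E) M ℂ k} (hα : IsSmoothForm α) (hβ : IsSmoothForm β) :
    MForm.cl2Inner o (dolbeaultLaplacian o k m h α) β =
      MForm.cl2Inner o α (dolbeaultLaplacian o k m h β) := by
  rcases k with - | k <;> rcases m with - | m
  · -- `Δ = 0`
    simp [dolbeaultLaplacian, MForm.cl2Inner_zero_left, MForm.cl2Inner_zero_right]
  · -- degree `0`: `Δ = ∂̄*∂̄`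
    have h1 : (0 + 1) + m = n := by omega
    have hΔ : ∀ γ : MForm 𝓘(ℝ, E) M ℂ 0,
        dolbeaultLaplacian o 0 (m + 1) h γ = dolbeaultBarAdjoint o h1 (dolbeaultBar γ) := fun γ ↦ rfl
    rw [hΔ, hΔ, cl2Inner_dolbeaultBarAdjoint_left_of_isHermitian o hJ ho h1 hβ hα.dolbeaultBar,
      ← MForm.cl2Inner_dolbeaultBar_left_of_isHermitian o hJ ho h1 hα hβ.dolbeaultBar]
  · -- top degree: `Δ = ∂̄∂̄*`
    have h1 : (k + 1) + 0 = n := by omega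
    have hΔ : ∀ γ : MForm 𝓘(ℝ, E) M ℂ (k + 1),
        dolbeaultLaplacian o (k + 1) 0 h γ = dolbeaultBar (dolbeaultBarAdjoint o h1 γ) := fun γ ↦ rfl
    rw [hΔ, hΔ,
      MForm.cl2Inner_dolbeaultBar_left_of_isHermitian o hJ ho h1
        (IsSmoothForm.dolbeaultBarAdjoint o ho h1 hα) hβ,
      ← cl2Inner_dolbeaultBarAdjoint_left_of_isHermitian o hJ ho h1
        (IsSmoothForm.dolbeaultBarAdjoint o ho h1 hβ) hα]
  · -- generic degree: `Δ = ∂̄∂̄* + ∂̄*∂̄`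
    have h2 : (k + 1 + 1) + m = n := by omega
    have hΔ : ∀ γ : MForm 𝓘(ℝ, E) M ℂ (k + 1),
        dolbeaultLaplacian o (k + 1) (m + 1) h γ = dolbeaultBar (dolbeaultBarAdjoint o h γ) +
          dolbeaultBarAdjoint o h2 (dolbeaultBar γ) := fun γ ↦ rfl
    have hBα : IsSmoothForm (dolbeaultBarAdjoint o h α) := IsSmoothForm.dolbeaultBarAdjoint o ho h hα
    have hBβ : IsSmoothForm (dolbeaultBarAdjoint o h β) := IsSmoothForm.dolbeaultBarAdjoint o ho h hβ
    have hB2α : IsSmoothForm (dolbeaultBarAdjoint o h2 (dolbeaultBar α)) :=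
      IsSmoothForm.dolbeaultBarAdjoint o ho h2 hα.dolbeaultBar
    have hB2β : IsSmoothForm (dolbeaultBarAdjoint o h2 (dolbeaultBar β)) :=
      IsSmoothForm.dolbeaultBarAdjoint o ho h2 hβ.dolbeaultBar
    rw [hΔ, hΔ, MForm.cl2Inner_add_left o ho h hBα.dolbeaultBar hB2α hβ,
      MForm.cl2Inner_add_right o ho h hα hBβ.dolbeaultBar hB2β,
      MForm.cl2Inner_dolbeaultBar_left_of_isHermitian o hJ ho h hBα hβ,
      cl2Inner_dolbeaultBarAdjoint_left_of_isHermitian o hJ ho h2 hβ hα.dolbeaultBar,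
      ← cl2Inner_dolbeaultBarAdjoint_left_of_isHermitian o hJ ho h hBβ hα,
      ← MForm.cl2Inner_dolbeaultBar_left_of_isHermitian o hJ ho h2 hα hβ.dolbeaultBar]

end Symmetric

/-! ### `Δ_∂̄` as a symmetric operator on `A^k(M; ℂ)` and on `A^{p,q}(M)` -/

namespace CL2SmoothForms

variable [MeasurableSpace E] [BorelSpace E] [T2Space M] [CompactSpace M]
  [Fact (IsSmoothForm (riemannianVolumeForm o))]

omit [FiniteDimensional ℂ E] [Fact (finrank ℝ E = n)] [IsManifold 𝓘(ℂ, E) ω M]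
  [IsManifold 𝓘(ℝ, E) ∞ M] [RiemannianBundle fun x : M ↦ TangentSpace 𝓘(ℝ, E) x]
  [IsContMDiffRiemannianBundle 𝓘(ℝ, E) ∞ E fun x : M ↦ TangentSpace 𝓘(ℝ, E) x] [MeasurableSpace E]
  [BorelSpace E] [T2Space M] [CompactSpace M] [Fact (IsSmoothForm (riemannianVolumeForm o))] in
/-- Two elements of `A^k(M; ℂ)` with the same form are equal. [folklore] -/
theorem toForm_inj {α β : CL2SmoothForms o k} : toForm o α = toForm o β ↔ α = β :=
  ⟨fun h ↦ Subtype.ext h, fun h ↦ h ▸ rfl⟩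

/-- **`Δ_∂̄ : A^k(M; ℂ) → A^k(M; ℂ)` as a `ℂ`-linear operator on the Hermitian inner product space
of smooth complex `k`-forms** (Voisin (2002), §5.1.4; linearity on smooth forms is
`dolbeaultLaplacian_add` / `dolbeaultLaplacian_smul`, smoothness `IsSmoothForm.dolbeaultLaplacian`).
[cite: VoisinHodgeI2002, §5.1.4, Def. 5.14] -/
def dolbeaultLaplacian (h : k + m = n) : CL2SmoothForms o k →ₗ[ℂ] CL2SmoothForms o k where
  toFun α := mk o (Literature.NumberTheory.Transcendental.dolbeaultLaplacian o k m h (toForm o α))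
    (IsSmoothForm.dolbeaultLaplacian o Fact.out h (isSmoothForm_toForm o α))
  map_add' α β := by
    apply (toForm_inj o).1
    simp only [toForm_mk, toForm_add]
    exact dolbeaultLaplacian_add o Fact.out h (isSmoothForm_toForm o α) (isSmoothForm_toForm o β)
  map_smul' c α := by
    apply (toForm_inj o).1
    simp only [toForm_mk, toForm_smul, RingHom.id_apply]
    exact dolbeaultLaplacian_smul o h c _

/-- `Δ_∂̄` on `A^k(M; ℂ)` is `dolbeaultLaplacian` on the underlying forms. [folklore] -/
@[simp]
theorem toForm_dolbeaultLaplacian (h : k + m = n) (α : CL2SmoothForms o k) :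
    toForm o (dolbeaultLaplacian o h α) =
      Literature.NumberTheory.Transcendental.dolbeaultLaplacian o k m h (toForm o α) :=
  rfl

variable [IsContinuousRiemannianBundle E (fun x : M ↦ TangentSpace 𝓘(ℝ, E) x)]

/-- **`Δ_∂̄` is a symmetric operator of `A^k(M; ℂ)`** for a Hermitian metric (instance form `hJ`):
`⟪Δ_∂̄ α, β⟫ = ⟪α, Δ_∂̄ β⟫` (`cl2Inner_dolbeaultLaplacian_comm`; Voisin (2002), Lemma 5.8 / proof of
Lemma 5.12). [cite: VoisinHodgeI2002, §5.1.4, Lemma 5.12] -/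
theorem dolbeaultLaplacian_isSymmetric
    (hJ : ∀ (x : M) (v w : TangentSpace 𝓘(ℝ, E) x),
      inner ℝ (tangentJ E x v) (tangentJ E x w) = inner ℝ v w)
    (h : k + m = n) : (dolbeaultLaplacian o h (k := k)).IsSymmetric := by
  intro α β
  rw [inner_def, inner_def, toForm_dolbeaultLaplacian, toForm_dolbeaultLaplacian]
  exact cl2Inner_dolbeaultLaplacian_comm o hJ Fact.out h (isSmoothForm_toForm o α)
    (isSmoothForm_toForm o β)

omit [IsContinuousRiemannianBundle E (fun x : M ↦ TangentSpace 𝓘(ℝ, E) x)] in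
/-- **The subspace `A^{p,q}(M) ≤ A^{p+q}(M; ℂ)` of smooth forms of type `(p,q)`** (Voisin (2002),
§2.3.1, Def. 2.24 / §5.1.4), as a `ℂ`-submodule of the inner product space `CL2SmoothForms o (p + q)`
(type is preserved by sums and complex multiples, `IsOfType.add`, `IsOfType.smul`; it inherits the
Hermitian `L²` inner product). [cite: VoisinHodgeI2002, §2.3.1] -/
def pq (p q : ℕ) : Submodule ℂ (CL2SmoothForms o (p + q)) where
  carrier := {α | IsOfType p q (toForm o α)}
  add_mem' {α β} hα hβ := by
    change IsOfType p q (toForm o (α + β))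
    rw [toForm_add]
    exact hα.add hβ
  zero_mem' := by
    change IsOfType p q (toForm o (0 : CL2SmoothForms o (p + q)))
    rw [toForm_zero]
    exact isOfType_zero rfl
  smul_mem' c α hα := by
    change IsOfType p q (toForm o (c • α))
    rw [toForm_smul]
    exact hα.smul c

omit [IsContinuousRiemannianBundle E (fun x : M ↦ TangentSpace 𝓘(ℝ, E) x)]
  [IsManifold 𝓘(ℂ, E) ω M] in
/-- Membership in `A^{p,q}` is being of type `(p,q)`. [folklore] -/
@[simp]
theorem mem_pq_iff {p q : ℕ} (α : CL2SmoothForms o (p + q)) :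
    α ∈ pq o p q ↔ IsOfType p q (toForm o α) :=
  Iff.rfl

omit [IsContinuousRiemannianBundle E (fun x : M ↦ TangentSpace 𝓘(ℝ, E) x)] in
/-- `Δ_∂̄` leaves `A^{p,q}` invariant (Hermitian metric; `IsOfType.dolbeaultLaplacian`).
[cite: VoisinHodgeI2002, §6.1.2] -/
theorem dolbeaultLaplacian_mem_pq
    (hJ : ∀ (x : M) (v w : TangentSpace 𝓘(ℝ, E) x),
      inner ℝ (tangentJ E x v) (tangentJ E x w) = inner ℝ v w)
    {p q : ℕ} (h : (p + q) + m = n) :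
    ∀ α ∈ pq o p q, dolbeaultLaplacian o h α ∈ pq o p q := by
  intro α hα
  rw [mem_pq_iff] at hα ⊢
  rw [toForm_dolbeaultLaplacian]
  exact hα.dolbeaultLaplacian o hJ h

omit [IsContinuousRiemannianBundle E (fun x : M ↦ TangentSpace 𝓘(ℝ, E) x)] in
/-- **`Δ_∂̄ : A^{p,q}(M) → A^{p,q}(M)`**, the restriction of `Δ_∂̄` to the forms of type `(p,q)`
(Voisin (2002), §5.1.4 / Thm. 5.24: `Δ_∂̄` acting on `A^{p,q}(X)`). [cite: VoisinHodgeI2002, Thm. 5.24] -/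
def pqLaplacian
    (hJ : ∀ (x : M) (v w : TangentSpace 𝓘(ℝ, E) x),
      inner ℝ (tangentJ E x v) (tangentJ E x w) = inner ℝ v w)
    (p q : ℕ) (h : (p + q) + m = n) : pq o p q →ₗ[ℂ] pq o p q :=
  (dolbeaultLaplacian o h).restrict (dolbeaultLaplacian_mem_pq o hJ h)

omit [IsContinuousRiemannianBundle E (fun x : M ↦ TangentSpace 𝓘(ℝ, E) x)] in
/-- The restricted Laplacian on underlying forms. [folklore] -/
@[simp]
theorem toForm_pqLaplacian
    (hJ : ∀ (x : M) (v w : TangentSpace 𝓘(ℝ, E) x),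
      inner ℝ (tangentJ E x v) (tangentJ E x w) = inner ℝ v w)
    {p q : ℕ} (h : (p + q) + m = n) (α : pq o p q) :
    toForm o ((pqLaplacian o hJ p q h α : pq o p q) : CL2SmoothForms o (p + q)) =
      Literature.NumberTheory.Transcendental.dolbeaultLaplacian o (p + q) m h
        (toForm o (α : CL2SmoothForms o (p + q))) :=
  rfl

/-- `Δ_∂̄` restricted to `A^{p,q}` is symmetric (restriction of a symmetric operator to an
invariant subspace). [cite: VoisinHodgeI2002, §5.1.4, Lemma 5.12] -/
theorem pqLaplacian_isSymmetric
    (hJ : ∀ (x : M) (v w : TangentSpace 𝓘(ℝ, E) x),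
      inner ℝ (tangentJ E x v) (tangentJ E x w) = inner ℝ v w)
    (p q : ℕ) (h : (p + q) + m = n) : (pqLaplacian o hJ p q h).IsSymmetric :=
  (dolbeaultLaplacian_isSymmetric o hJ h).restrict_invariant (dolbeaultLaplacian_mem_pq o hJ h)

omit [IsContinuousRiemannianBundle E (fun x : M ↦ TangentSpace 𝓘(ℝ, E) x)] in
/-- **`ker (Δ_∂̄|A^{p,q}) = ℋ^{p,q}`**: an element of `A^{p,q}` is in the kernel of the restricted
Laplacian iff its form is `∂̄`-harmonic of type `(p,q)` (`IsDolbeaultHarmonic`: smooth, of type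
`(p,q)`, `Δ_∂̄ = 0`; Voisin (2002), Def. 5.14). [cite: VoisinHodgeI2002, §5.1.4, Def. 5.14] -/
theorem mem_ker_pqLaplacian_iff
    (hJ : ∀ (x : M) (v w : TangentSpace 𝓘(ℝ, E) x),
      inner ℝ (tangentJ E x v) (tangentJ E x w) = inner ℝ v w)
    {p q : ℕ} (h : (p + q) + m = n) (α : pq o p q) :
    α ∈ LinearMap.ker (pqLaplacian o hJ p q h) ↔
      IsDolbeaultHarmonic o p q h (toForm o (α : CL2SmoothForms o (p + q))) := by
  rw [LinearMap.mem_ker, IsDolbeaultHarmonic]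
  constructor
  · intro h0
    refine ⟨isSmoothForm_toForm o _, α.2, ?_⟩
    have := congrArg (fun β : pq o p q ↦ toForm o (β : CL2SmoothForms o (p + q))) h0
    simpa only [toForm_pqLaplacian, Submodule.coe_zero, toForm_zero] using this
  · rintro ⟨-, -, h0⟩
    apply Subtype.ext
    apply (toForm_inj o).1
    rw [toForm_pqLaplacian, h0, Submodule.coe_zero, toForm_zero]

end CL2SmoothForms

/-! ### Voisin's Theorem 5.24 (i) and Theorem 5.22 (finiteness) from Warner 6.5 and 6.6 for `Δ_∂̄` -/

section Hodge

variable [MeasurableSpace E] [BorelSpace E] [T2Space M] [CompactSpace M]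
  [IsContinuousRiemannianBundle E (fun x : M ↦ TangentSpace 𝓘(ℝ, E) x)]
  [Fact (IsSmoothForm (riemannianVolumeForm o))]

/-- **Voisin's Theorem 5.24 (i), `A^{p,q}(M) = ℋ^{p,q} + Δ_∂̄(A^{p,q}(M))`, from Warner's Theorems
6.5 (regularity) and 6.6 (compactness) for `Δ_∂̄` on `A^{p,q}(M)`** (Voisin (2002), §5.3.1,
Thm. 5.24, from Thm. 5.22; Warner (1983), proof of Thm. 6.8, pp. 223–224, in the abstract form
`AbstractHodge.exists_mem_ker_add_eq`). Setting: compact complex manifold `M` (holomorphic atlas),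
`C^∞` metric on the real tangent bundle Hermitian in the instance form `hJ`, orientation family `o`
with smooth volume form (`Fact`); `V = CL2SmoothForms.pq o p q` with its Hermitian `L²` inner
product and `L = CL2SmoothForms.pqLaplacian o hJ p q h`. Hypotheses, verbatim Warner 6.6 and 6.5
for `L` on `V`: `hC` — bounded sequences with bounded `Δ_∂̄` have Cauchy subsequences; `hR` — every
weak solution `ℓ` of `Δ_∂̄ ω = α` (`ℓ (Δ_∂̄ φ) = ⟪α, φ⟫` for all `φ ∈ A^{p,q}`) is `⟪ω, ·⟫` for some
`ω ∈ A^{p,q}`. Conclusion: every smooth `(p,q)`-form is `η + Δ_∂̄ ω` with `η` `∂̄`-harmonic of type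
`(p,q)` and `ω` smooth of type `(p,q)`. [cite: VoisinHodgeI2002, Thm. 5.24 (i)] -/
theorem exists_isDolbeaultHarmonic_add_dolbeaultLaplacian_of_regularity_of_compactness
    (hJ : ∀ (x : M) (v w : TangentSpace 𝓘(ℝ, E) x),
      inner ℝ (tangentJ E x v) (tangentJ E x w) = inner ℝ v w)
    {p q : ℕ} (h : (p + q) + m = n)
    (hC : ∀ (u : ℕ → CL2SmoothForms.pq o p q) (c : ℝ), (∀ i, ‖u i‖ ≤ c) →
      (∀ i, ‖CL2SmoothForms.pqLaplacian o hJ p q h (u i)‖ ≤ c) →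
        ∃ φ : ℕ → ℕ, StrictMono φ ∧ CauchySeq (u ∘ φ))
    (hR : ∀ (α : CL2SmoothForms.pq o p q) (ℓ : CL2SmoothForms.pq o p q →L[ℂ] ℂ),
      (∀ φ, ℓ (CL2SmoothForms.pqLaplacian o hJ p q h φ) = ⟪α, φ⟫) →
        ∃ w : CL2SmoothForms.pq o p q, ∀ φ, ℓ φ = ⟪w, φ⟫)
    {α : MForm 𝓘(ℝ, E) M ℂ (p + q)} (hα : IsSmoothForm α) (ht : IsOfType p q α) :
    ∃ η w : MForm 𝓘(ℝ, E) M ℂ (p + q), IsDolbeaultHarmonic o p q h η ∧ IsSmoothForm w ∧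
      IsOfType p q w ∧ α = η + dolbeaultLaplacian o (p + q) m h w := by
  let a : CL2SmoothForms.pq o p q := ⟨CL2SmoothForms.mk o α hα, by simpa using ht⟩
  obtain ⟨hh, hhker, w, hdec⟩ := AbstractHodge.exists_mem_ker_add_eq
    (CL2SmoothForms.pqLaplacian_isSymmetric o hJ p q h) hC hR a
  refine ⟨CL2SmoothForms.toForm o (hh : CL2SmoothForms o (p + q)),
    CL2SmoothForms.toForm o (w : CL2SmoothForms o (p + q)),
    (CL2SmoothForms.mem_ker_pqLaplacian_iff o hJ h hh).1 hhker,
    CL2SmoothForms.isSmoothForm_toForm o _, (CL2SmoothForms.mem_pq_iff o _).1 w.2, ?_⟩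
  have := congrArg (fun β : CL2SmoothForms.pq o p q ↦
    CL2SmoothForms.toForm o (β : CL2SmoothForms o (p + q))) hdec
  simpa only [Submodule.coe_add, CL2SmoothForms.toForm_add, CL2SmoothForms.toForm_pqLaplacian,
    a, CL2SmoothForms.toForm_mk] using this

omit [IsContinuousRiemannianBundle E (fun x : M ↦ TangentSpace 𝓘(ℝ, E) x)] in
/-- **`ℋ^{p,q}` is finite-dimensional from Warner's compactness theorem 6.6 for `Δ_∂̄` on
`A^{p,q}(M)`** (Voisin (2002), Thm. 5.22 ⇒ Thm. 5.24 (ii); Warner (1983), proof of 6.8, first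
paragraph, p. 223, in the abstract form `AbstractHodge.finiteDimensional_ker`): the kernel of the
restricted Laplacian is finite-dimensional, and `ℋ^{p,q} = dolbeaultHarmonicForms o p q h` is its
image under the (injective) forgetful map to forms. No regularity hypothesis and no symmetry are
needed for this half. [cite: VoisinHodgeI2002, Thm. 5.24 (ii)] -/
theorem module_finite_dolbeaultHarmonicForms_of_compactness
    (hJ : ∀ (x : M) (v w : TangentSpace 𝓘(ℝ, E) x),
      inner ℝ (tangentJ E x v) (tangentJ E x w) = inner ℝ v w)
    {p q : ℕ} (h : (p + q) + m = n)
    (hC : ∀ (u : ℕ → CL2SmoothForms.pq o p q) (c : ℝ), (∀ i, ‖u i‖ ≤ c) →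
      (∀ i, ‖CL2SmoothForms.pqLaplacian o hJ p q h (u i)‖ ≤ c) →
        ∃ φ : ℕ → ℕ, StrictMono φ ∧ CauchySeq (u ∘ φ)) :
    Module.Finite ℂ ↥(dolbeaultHarmonicForms o p q h) := by
  haveI : FiniteDimensional ℂ (LinearMap.ker (CL2SmoothForms.pqLaplacian o hJ p q h)) :=
    AbstractHodge.finiteDimensional_ker _ hC
  -- the forgetful linear map `ker → forms`
  let f : LinearMap.ker (CL2SmoothForms.pqLaplacian o hJ p q h) →ₗ[ℂ] MForm 𝓘(ℝ, E) M ℂ (p + q) :=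
    (CL2SmoothForms.toFormₗ o).comp ((CL2SmoothForms.pq o p q).subtype.comp (Submodule.subtype _))
  have hf : ∀ x, f x = CL2SmoothForms.toForm o ((x : CL2SmoothForms.pq o p q) : CL2SmoothForms o (p + q)) :=
    fun x ↦ rfl
  have hrange : dolbeaultHarmonicForms o p q h = LinearMap.range f := by
    apply le_antisymm
    · rw [dolbeaultHarmonicForms, Submodule.span_le]
      intro β hβ
      have hβ' : IsDolbeaultHarmonic o p q h β := hβ
      let b : CL2SmoothForms.pq o p q := ⟨CL2SmoothForms.mk o β hβ'.1, by simpa using hβ'.2.1⟩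
      have hb : b ∈ LinearMap.ker (CL2SmoothForms.pqLaplacian o hJ p q h) :=
        (CL2SmoothForms.mem_ker_pqLaplacian_iff o hJ h b).2 (by simpa [b] using hβ')
      exact ⟨⟨b, hb⟩, by simp [hf, b]⟩
    · rintro _ ⟨x, rfl⟩
      rw [hf]
      exact ((CL2SmoothForms.mem_ker_pqLaplacian_iff o hJ h _).1 x.2).mem_dolbeaultHarmonicForms
  rw [hrange]
  exact Module.Finite.range f

end Hodge

/-! ### The named fact `finite_dolbeaultHarmonicForms` from the compactness theorem -/

section NamedFacts

omit [RiemannianBundle (fun x : M ↦ TangentSpace 𝓘(ℝ, E) x)]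
  [IsContMDiffRiemannianBundle 𝓘(ℝ, E) ∞ E (fun x : M ↦ TangentSpace 𝓘(ℝ, E) x)]

variable (g : ContMDiffRiemannianMetric 𝓘(ℝ, E) ∞ E (fun x : M ↦ TangentSpace 𝓘(ℝ, E) x))

/-- **The named fact `finite_dolbeaultHarmonicForms g o` (`ℋ^{p,q}` finite-dimensional on a compact
Hermitian manifold; Voisin (2002), Thm. 5.22 / Thm. 5.24) from Warner's compactness theorem 6.6
for `Δ_∂̄` on each `A^{p,q}(M)`.** The hypothesis `hC` is 6.6 for the metric `g` (installed as the
Riemannian bundle structure), for every bidegree and degree witness; bidegrees `p + q ≠ k` are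
trivial (`ℋ^{p,q} = ⊥` among `k`-forms). The Borel structure on `E` used to form the `L²` products
is the canonical one. [cite: VoisinHodgeI2002, Thm. 5.24 (ii)] -/
theorem finite_dolbeaultHarmonicForms_of_compactness
    (hC : ∀ [MeasurableSpace E] [BorelSpace E] [CompactSpace M] [T2Space M]
      (hJ : letI : RiemannianBundle (fun x : M ↦ TangentSpace 𝓘(ℝ, E) x) := ⟨g.toRiemannianMetric⟩
        ∀ (x : M) (v w : TangentSpace 𝓘(ℝ, E) x),
          inner ℝ (tangentJ E x v) (tangentJ E x w) = inner ℝ v w)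
      (p q : ℕ) (h : (p + q) + m = n)
      (ho : letI : RiemannianBundle (fun x : M ↦ TangentSpace 𝓘(ℝ, E) x) := ⟨g.toRiemannianMetric⟩
        IsSmoothForm (riemannianVolumeForm o)),
      letI : RiemannianBundle (fun x : M ↦ TangentSpace 𝓘(ℝ, E) x) := ⟨g.toRiemannianMetric⟩
      haveI : IsContMDiffRiemannianBundle 𝓘(ℝ, E) ∞ E (fun x : M ↦ TangentSpace 𝓘(ℝ, E) x) :=
        ⟨g.inner, g.contMDiff, fun _ _ _ ↦ rfl⟩
      haveI : Fact (IsSmoothForm (riemannianVolumeForm o)) := ⟨ho⟩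
      ∀ (u : ℕ → CL2SmoothForms.pq o p q) (c : ℝ), (∀ i, ‖u i‖ ≤ c) →
        (∀ i, ‖CL2SmoothForms.pqLaplacian o hJ p q h (u i)‖ ≤ c) →
          ∃ φ : ℕ → ℕ, StrictMono φ ∧ CauchySeq (u ∘ φ)) :
    finite_dolbeaultHarmonicForms (k := k) (m := m) g o := by
  intro _ _ hg p q h
  letI : RiemannianBundle (fun x : M ↦ TangentSpace 𝓘(ℝ, E) x) := ⟨g.toRiemannianMetric⟩
  haveI : IsContMDiffRiemannianBundle 𝓘(ℝ, E) ∞ E (fun x : M ↦ TangentSpace 𝓘(ℝ, E) x) :=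
    ⟨g.inner, g.contMDiff, fun _ _ _ ↦ rfl⟩
  haveI : IsContinuousRiemannianBundle E (fun x : M ↦ TangentSpace 𝓘(ℝ, E) x) :=
    ⟨g.inner, g.contMDiff.continuous, fun _ _ _ ↦ rfl⟩
  intro ho
  by_cases hpq : p + q = k
  · subst hpq
    letI : MeasurableSpace E := borel E
    haveI : BorelSpace E := ⟨rfl⟩
    haveI : Fact (IsSmoothForm (riemannianVolumeForm o)) := ⟨ho⟩
    have hJ : ∀ (x : M) (v w : TangentSpace 𝓘(ℝ, E) x),
        inner ℝ (tangentJ E x v) (tangentJ E x w) = inner ℝ v w := fun x v w ↦ hg x v w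
    exact module_finite_dolbeaultHarmonicForms_of_compactness o hJ h (hC hJ p q h ho)
  · rw [dolbeaultHarmonicForms_eq_bot_of_ne o hpq h]
    infer_instance

end NamedFacts

end Literature.NumberTheory.Transcendental
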